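import Summits.CriticalPhenomena.PercolationContinuityZ3.Theorems.PercNearOneGluingNoHeavyQuantThreePortBoxTilesA
import Summits.CriticalPhenomena.PercolationContinuityZ3.Theorems.PercNearOneGluingNoHeavyQuantThreePortBoxTilesB
import Summits.CriticalPhenomena.PercolationContinuityZ3.Theorems.PercNearOneGluingNoHeavyQuantThreePortBoxTilesC
import HarnessLib

/-!
# `Z(3,2)` at a three-port observer with hairs `≥ 3/10` — assembly of the box tiling

builds on p205010 (kernel theorem, internal audit signed; external expert review pending)

Support file (`--supports stmt-CriticalPhenomena-4575`), seat `prim-quant-p1` (gen 5); memo `run/shared/lean/prim/quant/P1-SURPLUS.md` §15–16.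
No definitions, no named facts, no sorries; standard axioms.

SETTING (`ThreePort`, as in `…QuantThreePortTwoFifths`): three-port observer `o` (pairs at `o` other than `o–a, o–b, o–c` have
weight `0`), hairs `α, β, γ`, ARBITRARY finite weighted graph off `o`, off-`o` cells `U0, Uab, Uac, Ubc, U3`.
`ThreePort.le_one_reached_le_of_cellSolver₂` (p222750) reduces `Z(3,2)` at `o` to refuting the real RESIDUAL SYSTEM
{cells `≥ 0`, `Σ = 1`, the three failed exchanges, the three Gladkov–Zimin rows, the six division-free Gladkov-Lemma-1.2 rows,
`Σ_v q_v > 2`}.  The refutation on the hair cube `[3/10, ½]³`: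
* `ThreePort.threeTenths_residual_false_sorted` — the sorted frame `3/10 ≤ γ ≤ β ≤ α ≤ ½`, using only the GZ row at the apex of
  the largest hair and the two weak Lemma-1.2 rows with factor `(Ubc + U0)`: the four tiles `tile_LL/LR/RL/RR_false`
  (`…QuantThreePortBoxTilesA/B/C`, 177 certified leaf boxes; each leaf is one generic box lemma — DT chain `dtBox_b/c_false`,
  GZ chain `gzBox_a_false`, or a vacuous box — whose exact-rational side condition `norm_num` verifies in the kernel).
* `ThreePort.threeTenths_residual_false` — all of `[3/10, ½]³`: relabel so that the hairs are sorted (six orders; the row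
  families are closed under relabelling, which is why `cellSolver₂` carries all three GZ rows and all six Lemma-1.2 rows).
* `ThreePort.le_one_reached_le_of_threeTenths_hairs` — **`Z(3,2)` at every three-port observer with hairs in `[3/10, ½]`, for
  every finite weighted graph off `o`**; `…_of_hairs_ge_threeTenths`: all hairs `≥ 3/10` suffice (a hair `≥ ½` is the heavy-hair
  theorem `pocketExchange_of_half_le_hair`).  Supersedes `…_of_hairs_ge_twoFifths` (p220774) and `…_of_hairs_ge` (`9/20`, p219549).
NUMBERS (memo §16).  The exact-rational tiler (`work/explore/boxes2.py`, seat folder) certifies `[3/10, ½]³` with 177 leaves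
(174 if every role assignment of the two chains is allowed); started at `h₀ = 11/40` it leaves 147 boxes uncertified at bisection
depth 18, at `h₀ = 1/4` 754 — going lower needs sharper use of the rows near the corner `U0 → 0` (the DT floor `U0 ≥ U0min`
degenerates as `κ_c(1+κ_a) → 1`), and in the near-dominant corner (`V_a ≤ 0`) the abstract residual system is feasible near glue
(memo §15), so no cell solver from the known rows exists there.
[cite: GladkovZimin2024, Thm. 4.6]; [cite: Gladkov2024, Lemma 1.2 (2)]; [cite: KozmaNitzan2024, Lemma 2 (p. 6)] (context).
-/

noncomputable section

namespace Summit.CriticalPhenomena.PercolationContinuityZ3.Theorems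

open MeasureTheory Set Literature.Probability.LatticeModels Literature.Probability.Percolation
open scoped Classical BigOperators

variable {n : ℕ}

namespace ThreePort

/-! ### Pure real algebra: the residual system on `[3/10, ½]³` -/

/-- **Sorted frame.**  On `3/10 ≤ γ ≤ β ≤ α ≤ ½` the residual system (cells, caps, the GZ row at apex `a`, the two weak Lemma-1.2
rows `U0² ≤ (Ubc+U0)(Uab+(Uac+U0)²)`, `U0² ≤ (Ubc+U0)(Uac+(Uab+U0)²)`, and `Σ > 2`) is contradictory: split at `α, β = 2/5` into
the four certified tiles. [this work] -/
theorem threeTenths_residual_false_sorted (α β γ U0 Uab Uac Ubc U3 : ℝ)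
    (a1 : 3 / 10 ≤ α) (a2 : α ≤ 1 / 2) (b1 : 3 / 10 ≤ β) (c1 : 3 / 10 ≤ γ) (hba : β ≤ α) (hcb : γ ≤ β)
    (h0 : 0 ≤ U0) (hab : 0 ≤ Uab) (hac : 0 ≤ Uac) (hbc : 0 ≤ Ubc) (h3 : 0 ≤ U3)
    (hsum : Uab + Uac + Ubc + U3 + U0 = 1)
    (ga : U0 * ((1 - α) * β * γ - α * (1 - β) * (1 - γ)) + Ubc * (β + γ - β * γ - α) < 0)
    (gb : U0 * ((1 - β) * α * γ - β * (1 - α) * (1 - γ)) + Uac * (α + γ - α * γ - β) < 0)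
    (gc : U0 * ((1 - γ) * α * β - γ * (1 - α) * (1 - β)) + Uab * (α + β - α * β - γ) < 0)
    (hGZa : (U0 + Ubc) * (Uab + Uac + U3) ≤ Uab + Uac + Ubc)
    (rB1 : U0 ^ 2 ≤ (Ubc + U0) * (Uab + (Uac + U0) ^ 2)) (rC1 : U0 ^ 2 ≤ (Ubc + U0) * (Uac + (Uab + U0) ^ 2))
    (hSig : 2 < (α + β + γ) + (α + β - 2 * α * β) * Uab + (α + γ - 2 * α * γ) * Uac + (β + γ - 2 * β * γ) * Ubc +
      ((1 - α) * (β + γ - β * γ) + (1 - β) * (α + γ - α * γ) + (1 - γ) * (α + β - α * β)) * U3) : False := by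
  have b2 : β ≤ 1 / 2 := hba.trans a2
  have c2 : γ ≤ 1 / 2 := hcb.trans b2
  rcases le_or_gt α (2 / 5) with hα | hα
  · rcases le_or_gt β (2 / 5) with hβ | hβ
    · exact tile_LL_false α β γ U0 Uab Uac Ubc U3 a1 hα b1 hβ c1 c2 hba hcb h0 hab hac hbc h3 hsum ga gb gc hGZa rB1
        rC1 hSig
    · exact tile_LR_false α β γ U0 Uab Uac Ubc U3 a1 hα hβ.le b2 c1 c2 hba hcb h0 hab hac hbc h3 hsum ga gb gc hGZa rB1
        rC1 hSig
  · rcases le_or_gt β (2 / 5) with hβ | hβ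
    · exact tile_RL_false α β γ U0 Uab Uac Ubc U3 hα.le a2 b1 hβ c1 c2 hba hcb h0 hab hac hbc h3 hsum ga gb gc hGZa rB1
        rC1 hSig
    · exact tile_RR_false α β γ U0 Uab Uac Ubc U3 hα.le a2 hβ.le b2 c1 c2 hba hcb h0 hab hac hbc h3 hsum ga gb gc hGZa
        rB1 rC1 hSig

/-- **Pure real algebra on the whole box `[3/10, ½]³`.**  Nonnegative cells summing to `1`, the three failed exchanges, the three
Gladkov–Zimin rows, the six division-free Lemma-1.2 rows (`a`-dictionary of `le_one_reached_le_of_cellSolver₂`) and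
`Σ_v μ(o↔v) > 2` are contradictory: relabel so that the hairs are sorted and apply `threeTenths_residual_false_sorted` with the
rows of that frame. [this work] -/
theorem threeTenths_residual_false (α β γ U0 Uab Uac Ubc U3 : ℝ)
    (hα0 : 3 / 10 ≤ α) (hα1 : α ≤ 1 / 2) (hβ0 : 3 / 10 ≤ β) (hβ1 : β ≤ 1 / 2) (hγ0 : 3 / 10 ≤ γ) (hγ1 : γ ≤ 1 / 2)
    (h0 : 0 ≤ U0) (hab : 0 ≤ Uab) (hac : 0 ≤ Uac) (hbc : 0 ≤ Ubc) (h3 : 0 ≤ U3)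
    (hsum : Uab + Uac + Ubc + U3 + U0 = 1)
    (ga : U0 * ((1 - α) * β * γ - α * (1 - β) * (1 - γ)) + Ubc * (β + γ - β * γ - α) < 0)
    (gb : U0 * ((1 - β) * α * γ - β * (1 - α) * (1 - γ)) + Uac * (α + γ - α * γ - β) < 0)
    (gc : U0 * ((1 - γ) * α * β - γ * (1 - α) * (1 - β)) + Uab * (α + β - α * β - γ) < 0)
    (hGZa : (U0 + Ubc) * (Uab + Uac + U3) ≤ Uab + Uac + Ubc)
    (hGZb : (U0 + Uac) * (Uab + Ubc + U3) ≤ Uab + Uac + Ubc)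
    (hGZc : (U0 + Uab) * (Uac + Ubc + U3) ≤ Uab + Uac + Ubc)
    (rA1 : U0 ^ 2 ≤ (Uac + U0) * (Uab + (Ubc + U0) ^ 2)) (rA2 : U0 ^ 2 ≤ (Uab + U0) * (Uac + (Ubc + U0) ^ 2))
    (rB1 : U0 ^ 2 ≤ (Ubc + U0) * (Uab + (Uac + U0) ^ 2)) (rB2 : U0 ^ 2 ≤ (Uab + U0) * (Ubc + (Uac + U0) ^ 2))
    (rC1 : U0 ^ 2 ≤ (Ubc + U0) * (Uac + (Uab + U0) ^ 2)) (rC2 : U0 ^ 2 ≤ (Uac + U0) * (Ubc + (Uab + U0) ^ 2))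
    (hSig : 2 < (α + β + γ) + (α + β - 2 * α * β) * Uab + (α + γ - 2 * α * γ) * Uac + (β + γ - 2 * β * γ) * Ubc +
      ((1 - α) * (β + γ - β * γ) + (1 - β) * (α + γ - α * γ) + (1 - γ) * (α + β - α * β)) * U3) : False := by
  rcases le_total β α with hβα | hαβ
  · rcases le_total γ β with hγβ | hβγ
    · -- `γ ≤ β ≤ α`: identity
      exact threeTenths_residual_false_sorted α β γ U0 Uab Uac Ubc U3 hα0 hα1 hβ0 hγ0 hβα hγβ h0 hab hac hbc h3 hsum ga
        gb gc hGZa rB1 rC1 hSig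
    · rcases le_total γ α with hγα | hαγ
      · -- `β ≤ γ ≤ α`: swap the roles of `b` and `c`
        exact threeTenths_residual_false_sorted α γ β U0 Uac Uab Ubc U3 hα0 hα1 hγ0 hβ0 hγα hβγ h0 hac hab hbc h3
          (by linarith only [hsum]) (by linarith only [ga]) (by linarith only [gc]) (by linarith only [gb])
          (by linarith only [hGZa]) rC1 rB1 (by linarith only [hSig])
      · -- `β ≤ α ≤ γ`: new roles `(a', b', c') = (c, a, b)`
        exact threeTenths_residual_false_sorted γ α β U0 Uac Ubc Uab U3 hγ0 hγ1 hα0 hβ0 hαγ hβα h0 hac hbc hab h3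
          (by linarith only [hsum]) (by linarith only [gc]) (by linarith only [ga]) (by linarith only [gb])
          (by linarith only [hGZc]) rA2 rB2 (by linarith only [hSig])
  · rcases le_total γ α with hγα | hαγ
    · -- `γ ≤ α ≤ β`: swap the roles of `a` and `b`
      exact threeTenths_residual_false_sorted β α γ U0 Uab Ubc Uac U3 hβ0 hβ1 hα0 hγ0 hαβ hγα h0 hab hbc hac h3
        (by linarith only [hsum]) (by linarith only [gb]) (by linarith only [ga]) (by linarith only [gc])
        (by linarith only [hGZb]) rA1 rC2 (by linarith only [hSig])
    · rcases le_total γ β with hγβ | hβγ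
      · -- `α ≤ γ ≤ β`: new roles `(a', b', c') = (b, c, a)`
        exact threeTenths_residual_false_sorted β γ α U0 Ubc Uab Uac U3 hβ0 hβ1 hγ0 hα0 hγβ hαγ h0 hbc hab hac h3
          (by linarith only [hsum]) (by linarith only [gb]) (by linarith only [gc]) (by linarith only [ga])
          (by linarith only [hGZb]) rC2 rA1 (by linarith only [hSig])
      · -- `α ≤ β ≤ γ`: new roles `(a', b', c') = (c, b, a)`
        exact threeTenths_residual_false_sorted γ β α U0 Ubc Uac Uab U3 hγ0 hγ1 hβ0 hα0 hβγ hαβ h0 hbc hac hab h3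
          (by linarith only [hsum]) (by linarith only [gc]) (by linarith only [gb]) (by linarith only [ga])
          (by linarith only [hGZc]) rB2 rA2 (by linarith only [hSig])

/-! ### The theorems at a three-port observer -/

/-- **`Z(3,2)` at a three-port observer with hairs in `[3/10, ½]`, for every graph off the observer.**  If `o` is adjacent (with
positive weight) only to `a, b, c`, the three hairs lie in `[3/10, ½]`, `Σ_v μ(o↔v) > 2` and `t ≥ μ(o↮v)` for `v = a, b, c`, then
`μ{o reaches at most one of a, b, c} ≤ t`.  Instance of `le_one_reached_le_of_cellSolver₂` with the solver
`threeTenths_residual_false`. [this work] -/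
theorem le_one_reached_le_of_threeTenths_hairs (w : Sym2 (Fin n) → unitInterval) (R : Finset (Fin n)) (o a b c : Fin n)
    (t : ℝ) (hR : R = {a, b, c}) (hao : a ≠ o) (hbo : b ≠ o) (hco : c ≠ o) (hab : a ≠ b) (hac : a ≠ c) (hbc : b ≠ c)
    (hobs : ∀ u, u ≠ o → u ≠ a → u ≠ b → u ≠ c → w s(o, u) = 0)
    (hαlo : (3 / 10 : ℝ) ≤ w s(o, a)) (hαhi : (w s(o, a) : ℝ) ≤ 1 / 2)
    (hβlo : (3 / 10 : ℝ) ≤ w s(o, b)) (hβhi : (w s(o, b) : ℝ) ≤ 1 / 2)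
    (hγlo : (3 / 10 : ℝ) ≤ w s(o, c)) (hγhi : (w s(o, c) : ℝ) ≤ 1 / 2)
    (hsum : 2 < (prodBernoulli w).real (openConn o a) + (prodBernoulli w).real (openConn o b) +
      (prodBernoulli w).real (openConn o c))
    (hta : (prodBernoulli w).real (openConn o a)ᶜ ≤ t) (htb : (prodBernoulli w).real (openConn o b)ᶜ ≤ t)
    (htc : (prodBernoulli w).real (openConn o c)ᶜ ≤ t) :
    (prodBernoulli w).real {ω : BondConfig (Fin n) | (R.filter fun v => ω ∈ openConn o v).card ≤ 1} ≤ t :=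
  le_one_reached_le_of_cellSolver₂ w R o a b c t hR hao hbo hco hab hac hbc hobs
    (fun U0 Uab Uac Ubc U3 h0 hab' hac' hbc' h3 hs ga gb gc hGZa hGZb hGZc rA1 rA2 rB1 rB2 rC1 rC2 hSig =>
      threeTenths_residual_false _ _ _ U0 Uab Uac Ubc U3 hαlo hαhi hβlo hβhi hγlo hγhi h0 hab' hac' hbc' h3 hs ga gb gc
        hGZa hGZb hGZc rA1 rA2 rB1 rB2 rC1 rC2 hSig)
    hsum hta htb htc

/-- **All three hairs `≥ 3/10` suffice** (no upper bound): if some hair is at least `½` the heavy-hair theorem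
`pocketExchange_of_half_le_hair` gives the exchange at the weakest relay; otherwise `le_one_reached_le_of_threeTenths_hairs`.
Supersedes `le_one_reached_le_of_hairs_ge_twoFifths`. [this work] -/
theorem le_one_reached_le_of_hairs_ge_threeTenths (w : Sym2 (Fin n) → unitInterval) (R : Finset (Fin n)) (o a b c : Fin n)
    (t : ℝ) (hR : R = {a, b, c}) (hao : a ≠ o) (hbo : b ≠ o) (hco : c ≠ o) (hab : a ≠ b) (hac : a ≠ c) (hbc : b ≠ c)
    (hobs : ∀ u, u ≠ o → u ≠ a → u ≠ b → u ≠ c → w s(o, u) = 0)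
    (hαlo : (3 / 10 : ℝ) ≤ w s(o, a)) (hβlo : (3 / 10 : ℝ) ≤ w s(o, b)) (hγlo : (3 / 10 : ℝ) ≤ w s(o, c))
    (hsum : 2 < (prodBernoulli w).real (openConn o a) + (prodBernoulli w).real (openConn o b) +
      (prodBernoulli w).real (openConn o c))
    (hta : (prodBernoulli w).real (openConn o a)ᶜ ≤ t) (htb : (prodBernoulli w).real (openConn o b)ᶜ ≤ t)
    (htc : (prodBernoulli w).real (openConn o c)ᶜ ≤ t) :
    (prodBernoulli w).real {ω : BondConfig (Fin n) | (R.filter fun v => ω ∈ openConn o v).card ≤ 1} ≤ t := by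
  by_cases hhi : (w s(o, a) : ℝ) ≤ 1 / 2 ∧ (w s(o, b) : ℝ) ≤ 1 / 2 ∧ (w s(o, c) : ℝ) ≤ 1 / 2
  · exact le_one_reached_le_of_threeTenths_hairs w R o a b c t hR hao hbo hco hab hac hbc hobs hαlo hhi.1 hβlo hhi.2.1
      hγlo hhi.2.2 hsum hta htb htc
  have hhalf : (1 / 2 : ℝ) ≤ w s(o, a) ∨ (1 / 2 : ℝ) ≤ w s(o, b) ∨ (1 / 2 : ℝ) ≤ w s(o, c) := by
    by_contra h
    push Not at h
    exact hhi ⟨h.1.le, h.2.1.le, h.2.2.le⟩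
  have ha : a ∈ R := (by simp [hR]); have hb : b ∈ R := (by simp [hR]); have hc : c ∈ R := by simp [hR]
  have hobs' : ∀ u, u ≠ o → u ≠ b → u ≠ a → u ≠ c → w s(o, u) = 0 := fun u h1 h2 h3 h4 => hobs u h1 h3 h2 h4
  have hobs'' : ∀ u, u ≠ o → u ≠ c → u ≠ a → u ≠ b → w s(o, u) = 0 := fun u h1 h2 h3 h4 => hobs u h1 h3 h4 h2
  set μ := prodBernoulli w with hμ
  rcases le_total (μ.real (openConn o a)) (μ.real (openConn o b)) with hqab | hqba
  · rcases le_total (μ.real (openConn o a)) (μ.real (openConn o c)) with hqac | hqca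
    · exact (OneCutFive.measureReal_le_one_le_compl_of_exchange w R o a b c ha hb hc hab hac hbc
        (pocketExchange_of_half_le_hair w o a b c hao hbo hco hab hac hbc hobs hhalf hqab hqac)).trans hta
    · have hhalf' : (1 / 2 : ℝ) ≤ w s(o, c) ∨ (1 / 2 : ℝ) ≤ w s(o, a) ∨ (1 / 2 : ℝ) ≤ w s(o, b) := by tauto
      exact (OneCutFive.measureReal_le_one_le_compl_of_exchange w R o c a b hc ha hb hac.symm hbc.symm hab
        (pocketExchange_of_half_le_hair w o c a b hco hao hbo hac.symm hbc.symm hab hobs'' hhalf' hqca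
          (hqca.trans hqab))).trans htc
  · rcases le_total (μ.real (openConn o b)) (μ.real (openConn o c)) with hqbc | hqcb
    · have hhalf' : (1 / 2 : ℝ) ≤ w s(o, b) ∨ (1 / 2 : ℝ) ≤ w s(o, a) ∨ (1 / 2 : ℝ) ≤ w s(o, c) := by tauto
      exact (OneCutFive.measureReal_le_one_le_compl_of_exchange w R o b a c hb ha hc hab.symm hbc hac
        (pocketExchange_of_half_le_hair w o b a c hbo hao hco hab.symm hbc hac hobs' hhalf' hqba hqbc)).trans htb
    · have hhalf' : (1 / 2 : ℝ) ≤ w s(o, c) ∨ (1 / 2 : ℝ) ≤ w s(o, a) ∨ (1 / 2 : ℝ) ≤ w s(o, b) := by tauto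
      exact (OneCutFive.measureReal_le_one_le_compl_of_exchange w R o c a b hc ha hb hac.symm hbc.symm hab
        (pocketExchange_of_half_le_hair w o c a b hco hao hbo hac.symm hbc.symm hab hobs'' hhalf' (hqcb.trans hqba)
          hqcb)).trans htc

end ThreePort

end Summit.CriticalPhenomena.PercolationContinuityZ3.Theorems

end
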